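import Summits.CriticalPhenomena.PercolationContinuityZ3.Theorems.PercNearOneGluingNoHeavyLowerTailStarSetWordDesignations
import Summits.CriticalPhenomena.PercolationContinuityZ3.Theorems.PercNearOneGluingNoHeavyLowerTailStarSetWordCaps
import Summits.CriticalPhenomena.PercolationContinuityZ3.Theorems.PercNearOneGluingNoHeavyLowerTailStarSetFamilyLoad
import Summits.CriticalPhenomena.PercolationContinuityZ3.Theorems.PercNearOneGluingNoHeavyLowerTailStarSetOmegaCliques
import HarnessLib

/-!
# `NoHeavyLowerTail` (stmt-CriticalPhenomena-4575) — the W_bal family of the residual bound (U1-PROOF.md §7, L7.1; blueprint §G4)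

Support file (prover `prim-gen-swap` gen 15; `--supports stmt-CriticalPhenomena-4575`).  No definitions, no named facts, no sorries.

Residual units `(S, X)` of type H (first open forest class `J = J*(S)` avoiding `r`, meeting the hub `X = {e, ē}` at `e`) whose pair
`(X, J)` is BALANCED — the dominator `N = dom X e = {e, v}` of `X` at `e` is not `J` and avoids `r` — request the class-word
`W_bal(X, J) = {X, J, N}` with the two designations `(X→ē, J→s, N→e)`, `(X→e, J→s, N→v)` (U1-PROOF L7.1).  All configurations of the
pair aggregate to `≤ θ_Xθ_J` (L2.2), the word is worth `≥ 2θ_Xθ_J` (`bal_word_cap_ge`), and a class-set `{X, J, N}` is the W_bal word of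
at most one pair (the chord `X` is its only non-forest class; `N = dom X e ≠ J` excludes the swapped reading).  Hence the family is paid
by HALF the capacity of its class-sets (STAR1 shape: one chord and two forest classes through a common port).

* `StarSet.bal_triple_le_cap` — `2θ_Xθ_J ≤ C_{{X,J,N}}`;
* `StarSet.familyBal_bound` — `Σ_{u ∈ U} W(S_u) ≤ ½ Σ_{T ∈ res(U)} C_T`.
-/

namespace Summit.CriticalPhenomena.PercolationContinuityZ3.Theorems

open Finset
open scoped BigOperators Classical

namespace StarSet

variable {ι V : Type*} [Fintype ι] [LinearOrder ι] [DecidableEq V]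

/-- **The W_bal word: `2θ_Xθ_J ≤ C_T`** for `T = {X, J, N}`, `X = {e, ē}`, `J = {e, s}`, `N = {e, v}` with `e, ē, s, v` as in L7.1
(all `≠ r`; `ē, s, v` pairwise distinct; `θ_X ≤ θ_N`). -/
theorem bal_triple_le_cap (P P' : ι → V) (r : V)
    (θ : ι → ℝ) (hθ0 : ∀ X, 0 ≤ θ X) (O : ι → V → ℝ) (hO0 : ∀ X d, 0 ≤ O X d) (Φ : ι → ℝ)
    (hO1 : ∀ X d, (P X = d ∨ P' X = d) → θ X ≤ (1 - θ X) * O X d)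
    (hO2 : ∀ X, Φ X ^ 2 ≤ O X (P X) * O X (P' X)) (hΦ4 : ∀ X, 4 * θ X ≤ Φ X) (hΦsq : ∀ X, θ X ≤ Φ X ^ 2)
    {X J N : ι} (hXJ : X ≠ J) (hXN : X ≠ N) (hJN : J ≠ N) {e ē s v : V}
    (heX : P X = e ∨ P' X = e) (hēX : P X = ē ∨ P' X = ē) (hsJ : P J = s ∨ P' J = s)
    (heN : P N = e ∨ P' N = e) (hvN : P N = v ∨ P' N = v)
    (heē : e ≠ ē) (hes : e ≠ s) (hev : e ≠ v) (hēs : ē ≠ s) (hsv : s ≠ v)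
    (her : e ≠ r) (hēr : ē ≠ r) (hsr : s ≠ r) (hvr : v ≠ r) (hdom : θ X ≤ θ N) :
    2 * (θ X * θ J) ≤
      ∑ δ ∈ (univ : Finset (ι → Bool)).filter (fun δ => (∀ K ∉ ({X, J, N} : Finset ι), δ K = false) ∧
          3 ≤ (({X, J, N} : Finset ι).image fun K => if δ K then P K else P' K).card ∧
          r ∉ ({X, J, N} : Finset ι).image fun K => if δ K then P K else P' K),
        ∏ K ∈ ({X, J, N} : Finset ι), O K (if δ K then P K else P' K) := by
  have hΦ0 : ∀ K, 0 ≤ Φ K := fun K => by linarith [hΦ4 K, hθ0 K]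
  have hOX : Φ X ^ 2 ≤ O X ē * O X e := odds_pair_of_ports P P' O Φ (sym2_eq_of_mem_of_mem heē.symm hēX heX) (hO2 X)
  have hON : Φ N ^ 2 ≤ O N e * O N v := odds_pair_of_ports P P' O Φ (sym2_eq_of_mem_of_mem hev heN hvN) (hO2 N)
  have h2 := bal_word_cap_ge (θ X) (θ N) (θ J) (Φ X) (Φ N) (O X ē) (O X e) (O N e) (O N v) (O J s)
    (hθ0 X) (hθ0 J) hdom (hΦ0 X) (hΦ0 N) (hΦsq X) (hΦsq N) (hO0 _ _) (hO0 _ _) (hO0 _ _) (hO0 _ _) (hO0 _ _)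
    (hO1 J s hsJ) hOX hON
  have hw := two_words_le_cap P P' r O hO0 hXJ hXN hJN hēX hsJ heN hēs heē.symm hes.symm hēr hsr her
    heX hsJ hvN hes hev hsv her hsr hvr (Or.inl heē.symm)
  have : O X ē * O N e * O J s + O X e * O N v * O J s = O X ē * O J s * O N e + O X e * O J s * O N v := by ring
  linarith

/-- **The W_bal family bound (U1-PROOF L7.1).**  For any finite set `U` of units `(S, X)` — hub `X = u.2 ∈ S` a chord avoiding `r`, forest
partner `J = Jof u ∈ S` avoiding `r`, meeting `X` at the port `eof u`, with the dominator `N = dom X (eof u)` avoiding `r` and `≠ J` —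
`Σ_{u∈U} W(S_u) ≤ ½ · Σ_{T ∈ U.image ({X, J, N})} C_T`. -/
theorem familyBal_bound (P P' : ι → V) (hPP' : ∀ X, P X ≠ P' X)
    (hinj : Function.Injective fun X => (s(P X, P' X) : Sym2 V)) (r : V) (F : Finset ι)
    (θ : ι → ℝ) (hθ0 : ∀ X, 0 ≤ θ X) (hθ1 : ∀ X, θ X ≤ 1) (O : ι → V → ℝ) (hO0 : ∀ X d, 0 ≤ O X d) (Φ : ι → ℝ)
    (hO1 : ∀ X d, (P X = d ∨ P' X = d) → θ X ≤ (1 - θ X) * O X d)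
    (hO2 : ∀ X, Φ X ^ 2 ≤ O X (P X) * O X (P' X)) (hΦ4 : ∀ X, 4 * θ X ≤ Φ X) (hΦsq : ∀ X, θ X ≤ Φ X ^ 2)
    (dom : ι → V → ι)
    (hdom : ∀ X ∉ F, ∀ d, (P X = d ∨ P' X = d) →
      dom X d ∈ F ∧ (P (dom X d) = d ∨ P' (dom X d) = d) ∧
        (∀ u, (P (dom X d) = u ∨ P' (dom X d) = u) → (P X = u ∨ P' X = u) → u = d) ∧ θ X ≤ θ (dom X d))
    (U : Finset (Finset ι × ι)) (Jof : Finset ι × ι → ι) (eof : Finset ι × ι → V)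
    (hU : ∀ u ∈ U, u.2 ∈ u.1 ∧ u.2 ∉ F ∧ (P u.2 ≠ r ∧ P' u.2 ≠ r) ∧ Jof u ∈ u.1 ∧ Jof u ∈ F ∧ (P (Jof u) ≠ r ∧ P' (Jof u) ≠ r) ∧
      (P u.2 = eof u ∨ P' u.2 = eof u) ∧ (P (Jof u) = eof u ∨ P' (Jof u) = eof u) ∧
      dom u.2 (eof u) ≠ Jof u ∧ (P (dom u.2 (eof u)) ≠ r ∧ P' (dom u.2 (eof u)) ≠ r)) :
    ∑ u ∈ U, ((∏ k ∈ u.1, θ k) * ∏ k ∈ univ \ u.1, (1 - θ k)) ≤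
      (1 / 2) * ∑ T ∈ U.image (fun u => ({u.2, Jof u, dom u.2 (eof u)} : Finset ι)),
        ∑ δ ∈ (univ : Finset (ι → Bool)).filter (fun δ => (∀ K ∉ T, δ K = false) ∧
            3 ≤ (T.image fun K => if δ K then P K else P' K).card ∧ r ∉ T.image fun K => if δ K then P K else P' K),
          ∏ K ∈ T, O K (if δ K then P K else P' K) := by
  -- port data of a unit
  have hports : ∀ u ∈ U, ∃ ē s v : V, (P u.2 = ē ∨ P' u.2 = ē) ∧ (P (Jof u) = s ∨ P' (Jof u) = s) ∧
      (P (dom u.2 (eof u)) = eof u ∨ P' (dom u.2 (eof u)) = eof u) ∧ (P (dom u.2 (eof u)) = v ∨ P' (dom u.2 (eof u)) = v) ∧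
      eof u ≠ ē ∧ eof u ≠ s ∧ eof u ≠ v ∧ ē ≠ s ∧ s ≠ v ∧ eof u ≠ r ∧ ē ≠ r ∧ s ≠ r ∧ v ≠ r ∧
      u.2 ≠ Jof u ∧ u.2 ≠ dom u.2 (eof u) ∧ dom u.2 (eof u) ∈ F ∧ θ u.2 ≤ θ (dom u.2 (eof u)) := by
    intro u hu
    obtain ⟨-, hXF, hXr, -, hJF, hJr, heX, heJ, hNJ, hNr⟩ := hU u hu
    obtain ⟨hNF, heN, hNother, hθN⟩ := hdom u.2 hXF (eof u) heX
    -- the other ports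
    obtain ⟨ē, hēX, heē⟩ : ∃ ē, (P u.2 = ē ∨ P' u.2 = ē) ∧ eof u ≠ ē := by
      rcases heX with h | h
      · exact ⟨P' u.2, Or.inr rfl, fun h' => hPP' u.2 (h.trans h')⟩
      · exact ⟨P u.2, Or.inl rfl, fun h' => hPP' u.2 (h'.symm.trans h.symm)⟩
    obtain ⟨s, hsJ, hes⟩ : ∃ s, (P (Jof u) = s ∨ P' (Jof u) = s) ∧ eof u ≠ s := by
      rcases heJ with h | h
      · exact ⟨P' (Jof u), Or.inr rfl, fun h' => hPP' (Jof u) (h.trans h')⟩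
      · exact ⟨P (Jof u), Or.inl rfl, fun h' => hPP' (Jof u) (h'.symm.trans h.symm)⟩
    obtain ⟨v, hvN, hev⟩ : ∃ v, (P (dom u.2 (eof u)) = v ∨ P' (dom u.2 (eof u)) = v) ∧ eof u ≠ v := by
      rcases heN with h | h
      · exact ⟨P' (dom u.2 (eof u)), Or.inr rfl, fun h' => hPP' _ (h.trans h')⟩
      · exact ⟨P (dom u.2 (eof u)), Or.inl rfl, fun h' => hPP' _ (h'.symm.trans h.symm)⟩
    have hXJ : u.2 ≠ Jof u := fun h => hXF (h ▸ hJF)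
    have hXN : u.2 ≠ dom u.2 (eof u) := fun h => hXF (h ▸ hNF)
    -- `s ≠ ē` (else `J ∥ X`), `v ≠ s` (else `N ∥ J`)
    have hēs : ē ≠ s := by
      intro h
      apply hXJ
      apply hinj
      simp only
      rw [sym2_eq_of_mem_of_mem heē heX hēX, sym2_eq_of_mem_of_mem hes heJ hsJ, h]
    have hsv : s ≠ v := by
      intro h
      apply hNJ
      apply hinj
      simp only
      rw [sym2_eq_of_mem_of_mem hev heN hvN, sym2_eq_of_mem_of_mem hes heJ hsJ, h]
    have her : eof u ≠ r := by
      rcases heX with h | h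
      · rw [← h]; exact hXr.1
      · rw [← h]; exact hXr.2
    have hēr : ē ≠ r := by
      rcases hēX with h | h
      · rw [← h]; exact hXr.1
      · rw [← h]; exact hXr.2
    have hsr : s ≠ r := by
      rcases hsJ with h | h
      · rw [← h]; exact hJr.1
      · rw [← h]; exact hJr.2
    have hvr : v ≠ r := by
      rcases hvN with h | h
      · rw [← h]; exact hNr.1
      · rw [← h]; exact hNr.2
    exact ⟨ē, s, v, hēX, hsJ, heN, hvN, heē, hes, hev, hēs, hsv, her, hēr, hsr, hvr, hXJ, hXN, hNF, hθN⟩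
  refine family_load_le θ hθ0 hθ1 U (fun u => ({u.2, Jof u, dom u.2 (eof u)} : Finset ι)) (fun u => (u.2, Jof u))
    (fun u => ({u.2, Jof u} : Finset ι))
    (fun T => ∑ δ ∈ (univ : Finset (ι → Bool)).filter (fun δ => (∀ K ∉ T, δ K = false) ∧
        3 ≤ (T.image fun K => if δ K then P K else P' K).card ∧ r ∉ T.image fun K => if δ K then P K else P' K),
      ∏ K ∈ T, O K (if δ K then P K else P' K))
    (fun u _ => sum_nonneg fun δ _ => prod_nonneg fun K _ => hO0 _ _) 1 2 (by norm_num)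
    (fun u hu => ?_) (fun u _ v _ _ hk => ?_) (fun u _ v _ _ hk huv => ?_) (fun u hu => ?_) (fun w hw => ?_) |>.trans ?_
  · -- cylinder ⊆ configuration
    obtain ⟨hXS, -, -, hJS, -⟩ := hU u hu
    intro k hk
    rcases mem_insert.1 hk with rfl | hk
    · exact hXS
    · rw [mem_singleton.1 hk]; exact hJS
  · -- same key ⇒ same cylinder
    have h1 : u.2 = v.2 := (congrArg Prod.fst hk :)
    have h2 : Jof u = Jof v := (congrArg Prod.snd hk :)
    simp only [h1, h2]
  · -- same key and configuration ⇒ same unit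
    exact Prod.ext huv (congrArg Prod.fst hk :)
  · -- `θ_Xθ_J ≤ C_T / 2`
    obtain ⟨ē, s, v, hēX, hsJ, heN, hvN, heē, hes, hev, hēs, hsv, her, hēr, hsr, hvr, hXJ, hXN, -, hθN⟩ := hports u hu
    obtain ⟨-, -, -, -, -, -, heX, heJ, hNJ, -⟩ := hU u hu
    rw [prod_pair hXJ, le_div_iff₀ (by norm_num : (0 : ℝ) < 2), mul_comm]
    exact bal_triple_le_cap P P' r θ hθ0 O hO0 Φ hO1 hO2 hΦ4 hΦsq hXJ hXN (Ne.symm hNJ) heX hēX hsJ heN hvN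
      heē hes hev hēs hsv her hēr hsr hvr hθN
  · -- at most one key per class-set
    refine card_le_one.2 fun a ha b hb => ?_
    obtain ⟨u, hu, rfl⟩ := mem_image.1 ha
    obtain ⟨v, hv, rfl⟩ := mem_image.1 hb
    obtain ⟨huU, huw⟩ := mem_filter.1 hu
    obtain ⟨hvU, hvw⟩ := mem_filter.1 hv
    obtain ⟨-, hXF, -, -, hJF, -, heX, heJ, hNJ, -⟩ := hU u huU
    obtain ⟨-, hXF', -, -, hJF', -, heX', heJ', hNJ', -⟩ := hU v hvU
    have hNF : dom u.2 (eof u) ∈ F := (hdom u.2 hXF (eof u) heX).1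
    have hNF' : dom v.2 (eof v) ∈ F := (hdom v.2 hXF' (eof v) heX').1
    have hT : ({u.2, Jof u, dom u.2 (eof u)} : Finset ι) = {v.2, Jof v, dom v.2 (eof v)} := huw.trans hvw.symm
    -- the hubs agree: the unique chord of the class-set
    have hX : u.2 = v.2 := by
      have h : u.2 ∈ ({v.2, Jof v, dom v.2 (eof v)} : Finset ι) := by rw [← hT]; exact mem_insert_self _ _
      rcases mem_insert.1 h with h | h
      · exact h
      rcases mem_insert.1 h with h | h
      · exact absurd (h ▸ hJF') hXF
      · exact absurd ((mem_singleton.1 h) ▸ hNF') hXF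
    -- the partners agree
    have hJ : Jof u = Jof v := by
      have h : Jof u ∈ ({v.2, Jof v, dom v.2 (eof v)} : Finset ι) := by
        rw [← hT]; exact mem_insert_of_mem (mem_insert_self _ _)
      rcases mem_insert.1 h with h | h
      · exact absurd (h ▸ hJF) hXF'
      rcases mem_insert.1 h with h | h
      · exact h
      · -- `Jof u = dom v.2 (eof v)`: then `Jof v = dom u.2 (eof u)` and the common ports coincide
        have hJu : Jof u = dom v.2 (eof v) := mem_singleton.1 h
        have hJv : Jof v ∈ ({u.2, Jof u, dom u.2 (eof u)} : Finset ι) := by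
          rw [hT]; exact mem_insert_of_mem (mem_insert_self _ _)
        have hJv' : Jof v = dom u.2 (eof u) := by
          rcases mem_insert.1 hJv with h' | h'
          · exact absurd (h' ▸ hJF') hXF
          rcases mem_insert.1 h' with h' | h'
          · exact absurd (h'.trans hJu).symm hNJ'
          · exact mem_singleton.1 h'
        -- `eof v` is a common port of `v.2 = u.2` and `Jof v = dom u.2 (eof u)`, hence `= eof u`
        obtain ⟨-, -, hother, -⟩ := hdom u.2 hXF (eof u) heX
        have heq : eof v = eof u := hother (eof v) (hJv' ▸ heJ') (hX ▸ heX')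
        rw [hJu, ← hX, heq] at hNJ
        exact absurd rfl hNJ
    rw [hX, hJ]
  · -- the resource sum is the class-set sum
    exact le_of_eq (by ring)

end StarSet

end Summit.CriticalPhenomena.PercolationContinuityZ3.Theorems
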